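/-
Copyright (c) 2026 the pub-hodgecm-mathlib formalisation cell (harness21).  Prover seat hodgecm-mathlib-LA3-p01 (g2), «GO 500» half A line L3
(socket `stub_FROB`, road ROOF → `stub_ROOF0`, road of record (ρ-𝔟)), organ #3-bis «THE LEGS, WITHOUT A MODEL DUAL OF THE SERRE FAMILY»; 2026-09-02.
-/
import Literature.AlgebraicGeometry.AbelianSchemes.RoofLegsSpecialFibre
import Literature.AlgebraicGeometry.AbelianSchemes.AbelianSchemeHomReductionSpecialFibreComp
import HarnessLib

/-!
# The legs of the downstairs roof WITHOUT a model-level dual pair of the Serre family: `q̄ : 𝒜_{x̄} → 𝒞_{x̄″}` flat surjective, equivariant, carrying sections,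
# and `q̄^*λ_B̄ = N·λ_{x̄}` for ANY downstairs `λ_B̄` with `c̄^*λ_B̄ = N·λ_{x̄″}` — the polarisation law reduced THROUGH `𝒜` (★ (ν8h))

Topic `AlgebraicGeometry/AbelianSchemes`, namespace `Literature.AlgebraicGeometry.AbelianSchemes.AbelianSchemeOver`.  THEOREMS ONLY (no definition, no named fact,
no `instance`, no notation, no `sorry`).  Cell `hodgecm-mathlib` (D-0151), F0∕P6 «MOD», «GO 500» line L3 (socket `stub_FROB` of the D-line), road ROOF → `stub_ROOF0`, ROAD
OF RECORD (ρ-𝔟) (LA3-plan (g0) RULINGS #5–#7): the middle of `Roof₀` is the Serre-family fibre `B̄ = 𝒞_{x̄″}` with the dual pair `DQ.ofIso E` TRANSPORTED from the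
ideal-torsion quotient (★ `QuotientDualPairKernelLawOfIdealClass`, ★ `IdealTorsionQuotientClassInvariance`) and `λ_B̄ := E⁻¹ ≫ ξ` (★ `IdealTorsionQuotientTwistHom`) — data
that live ONLY at the special point `x̄″`.  ★ organ #3 `RoofLegsSpecialFibre` obtains (r3₀-q) by ★ (ν8)(iv), which transports laws of MODEL-LEVEL polarisations of the target
family `𝒞 = 𝒜 ⊗ 𝔟` and therefore asks for `Db : 𝒞.DualPair` over the model; THIS file removes that input: the law is reduced THROUGH `𝒜` — the post-composite
`q′ ≫ ψ′_{x″} : 𝒜_x → 𝒜_{x″}` (`ψ′ : 𝒞 → 𝒜` the Serre cover, `ψ_P ≫ ψ′ = [N]`) carries `λ` to `N²·λ` with `𝒜`'s own polarisation on both sides, ★ (ν8h)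
`exists_specialFibre_hom_reduction_comp` (iv-h) transfers it to `q̄ ≫ ψ′_{x̄″}`, and downstairs `q̄^*λ_B̄ = N·λ_{x̄}` follows for every `λ_B̄` with `c̄^*λ_B̄ = N·λ_{x̄″}` by
cancelling `c̄ = ψ_P` (flat surjective; dual quasi-inverse `c̄^∨ ≫ (ψ′)^∨ = [N]`, ★ `dualIsogenyOver_coverLeg_comp_eq_pow_id`) and dividing by `[N]` (fppf, any characteristic).
`--supports stmt-HodgeConjecture-24832`, count-neutral.  HONEST LABEL: HC_CM is proved only modulo the cell's 2 remaining named inputs (hLiu418 24832, h413 24833) until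
rung 0 closes; this file discharges none of them.

## Mathematics

([SerreTate1968] §1; [BoschLutkebohmertRaynaud1990] §1.2 Prop. 8, §7.3 Prop. 6; [MumfordAV1970] §7 Thm. 4, §15 Thm. 1, §23 Thm. 2; [Conrad2004GrossZagier] §7 Thm. 7.5.)
QUASI-INVERSE TRANSFER (§1): for homomorphisms `c : A″ → B`, `d : B → A″` of abelian schemes over a reduced locally Noetherian base with `c ≫ d = [N]`, `c^∨ ≫ d^∨ = [N]`,
`c` fppf, dual pairs with unit pins, and dual homomorphisms `λ″`, `λ_B` with `c^*λ_B = N·λ″`: **`d^*λ″ = λ_B ≫ [N]`** (both sides pull back along `c` to `λ″ ≫ [N²]`; cancel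
`c` left, `c^∨` right).  Hence (§1) UPSTAIRS `(q ≫ d)^*λ″ = λ ≫ [N²]` from `q^*λ_B = N·λ` (multiply), and DOWNSTAIRS `q̄^*λ_B̄ = N·λ̄` from `(q̄ ≫ ψ′)^*λ̄″ = λ̄ ≫ [N²]`
(divide, ★ `comp_lam_comp_dualIsogenyOver_of_comp_mulN`).  §2 HEAD: ★ organ #2 recognition `E : 𝒞_{x″} ≅ B` (`c̄_η ≫ E = c`), `q′ := q ≫ E⁻¹`, `d := E⁻¹ ≫ ψ′_{x″}`
(`c ≫ d = [N]`, `d ≫ c = [N]` by ★ `serreTranslate_comp_serreTranslateInv` ∕ ★ `coverLegInv_comp_coverLeg`), ★ (ν8h) ONCE for `q′` with `h := ψ′`, `ℰ := 𝒜`.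

## Contents
* §1 `comp_lam_comp_dualIsogenyOver_eq_comp_mulN_of_quasiInverse` (the quasi-inverse transfer), `comp_comp_lam_comp_dualIsogenyOver_of_quasiInverse` (upstairs,
  multiply), `comp_lam_comp_dualIsogenyOver_of_postcomp_of_quasiInverse` (downstairs, divide).
* §2 **`exists_roofLeg_specialFibre_of_downstairsDual`** — THE HEAD (sections edition, as ★ `exists_roofLeg_specialFibre_sections` minus `Db`, `λ′`).

## References
* [SerreTate1968] J.-P. Serre, J. Tate, *Good reduction of abelian varieties*, Ann. of Math. 88 (1968), §1.
* [BoschLutkebohmertRaynaud1990] S. Bosch, W. Lütkebohmert, M. Raynaud, *Néron Models* (1990), §1.2 Prop. 8, §7.3 Prop. 6 (p. 180).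
* [MumfordAV1970] D. Mumford, *Abelian Varieties* (1970), §7 Thm. 4 (p. 72), §15 Thm. 1 (p. 143), §23 Thm. 2 (p. 231).
* [Conrad2004GrossZagier] B. Conrad, *Gross–Zagier revisited*, MSRI Publ. 49 (2004), §7 (Thm. 7.5).
* [RapoportSmithlingZhang2020Diagonal] M. Rapoport, B. Smithling, W. Zhang (2020), §4.3 (4.23) (p. 21).
* [MumfordFogartyKirwan1994] D. Mumford, J. Fogarty, F. Kirwan, *GIT*, 3rd ed. (1994), Ch. 6 §1 Cor. 6.5 (p. 117), Ch. 7 §2 Def. 7.2 (p. 129).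
-/

set_option autoImplicit false

noncomputable section

set_option backward.isDefEq.respectTransparency false

open CategoryTheory CategoryTheory.Limits AlgebraicGeometry MonoidalCategory CartesianMonoidalCategory
open scoped MonObj CategoryTheory.Obj NumberField
open Literature.AlgebraicGeometry.Motives
open IsDedekindDomain IsDedekindDomain.HeightOneSpectrum ValuativeRel
open Literature.NumberTheory.EllipticCurves (genericFibre specGenericPoint)
open Literature.NumberTheory.GaloisRepresentations (closureValuationSubring)
open Literature.NumberTheory.DiophantineGeometry

namespace Literature.AlgebraicGeometry.AbelianSchemes

namespace AbelianSchemeOver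

universe u

/-! ## §1 The quasi-inverse transfer of a pull-back law, and its two uses (multiply upstairs, divide downstairs) -/

section QuasiInverse

variable {S : Scheme.{u}} [IsReduced S] [IsLocallyNoetherian S] {A A'' B : AbelianSchemeOver S}
  (DA : A.DualPair) (DA'' : A''.DualPair) (DB : B.DualPair)
  (hDA : Nonempty ((Scheme.Modules.pullback (DualPair.unitHatSlice DA)).obj DA.P ≅ SheafOfModules.unit _))
  (hDA'' : Nonempty ((Scheme.Modules.pullback (DualPair.unitHatSlice DA'')).obj DA''.P ≅ SheafOfModules.unit _))
  (hDB : Nonempty ((Scheme.Modules.pullback (DualPair.unitHatSlice DB)).obj DB.P ≅ SheafOfModules.unit _))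
  (c : A''.X ⟶ B.X) [IsMonHom c] (d : B.X ⟶ A''.X) [IsMonHom d]
  (lam : A.X ⟶ DA.hat.X) (lam'' : A''.X ⟶ DA''.hat.X) (lamB : B.X ⟶ DB.hat.X) [IsMonHom lam] [IsMonHom lam''] [IsMonHom lamB]
  {N : ℕ} (hN : N ≠ 0) (hcd : c ≫ d = (𝟙 A''.X) ^ N)
  (hχ : DualPair.dualIsogenyOver c DA'' DB ≫ DualPair.dualIsogenyOver d DB DA'' = (𝟙 DB.hat.X) ^ N)
  (hc : c ≫ lamB ≫ DualPair.dualIsogenyOver c DA'' DB = lam'' ≫ DA''.hat.mulN N)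

include hDA'' hDB hN hcd hχ hc in
/-- **THE QUASI-INVERSE TRANSFER.**  `c : A″ → B` fppf and `d : B → A″` with `c ≫ d = [N]`, `c^∨ ≫ d^∨ = [N]` (`N ≠ 0`); dual homomorphisms `λ″` of `A″`, `λ_B` of `B` with
`c ≫ λ_B ≫ c^∨ = λ″ ≫ [N]`.  THEN **`d ≫ λ″ ≫ d^∨ = λ_B ≫ [N]`**: both sides pull back along `c` to `λ″ ≫ [N²]` (`(c ≫ d)^∨ = d^∨ ≫ c^∨`, `[N]^∨ = [N]`, ★ `dualIsogenyOver_comp`,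
★ `dualIsogenyOver_mulN`; ★ `comp_comp_mulN_comp_dualIsogenyOver`), then cancel `c` on the left (★ `cancel_left_of_flat_surjective`) and `c^∨` on the right (★
`cancel_right_of_comp_eq_pow_id` with the quasi-inverse `d^∨`). [cite: MumfordAV1970, §15 Thm. 1 (p. 143) and §23 Thm. 2 (p. 231)] [cite: MumfordAV1970, §7 Thm. 4 (p. 72)] -/
theorem comp_lam_comp_dualIsogenyOver_eq_comp_mulN_of_quasiInverse [Flat c.left] [Surjective c.left] [QuasiCompact c.left] :
    d ≫ lam'' ≫ DualPair.dualIsogenyOver d DB DA'' = lamB ≫ DB.hat.mulN N := by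
  haveI := DualPair.isMonHom_dualIsogenyOver c DA'' DB hDB hDA''
  haveI := DualPair.isMonHom_dualIsogenyOver d DB DA'' hDA'' hDB
  haveI : IsCommMonObj A''.X := A''.isCommMonObj_of_isReduced_base
  haveI : IsCommMonObj DB.hat.X := DB.hat.isCommMonObj_of_isReduced_base
  haveI : IsMonHom (A''.mulN N) := A''.isMonHom_mulN N
  haveI : IsMonHom (DB.hat.mulN N) := DB.hat.isMonHom_mulN N
  -- both sides pull back along `c` to `λ″ ≫ [N·N]`
  have h1 : c ≫ (d ≫ lam'' ≫ DualPair.dualIsogenyOver d DB DA'') ≫ DualPair.dualIsogenyOver c DA'' DB = lam'' ≫ DA''.hat.mulN (N * N) := by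
    have e1 : c ≫ (d ≫ lam'' ≫ DualPair.dualIsogenyOver d DB DA'') ≫ DualPair.dualIsogenyOver c DA'' DB =
        (c ≫ d) ≫ lam'' ≫ DualPair.dualIsogenyOver (c ≫ d) DA'' DA'' := by
      rw [DualPair.dualIsogenyOver_comp c d DA'' DB DA'']; simp only [Category.assoc]
    rw [e1, DualPair.dualIsogenyOver_congr DA'' DA'' (ψ₂ := A''.mulN N) (h₂ := inferInstance) hcd, hcd, ← mulN_def,
      DualPair.dualIsogenyOver_mulN DA'' hDA'' N, ← Category.assoc, mulN_comp_of_isMonHom lam'' N, Category.assoc, mulN_comp_mulN]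
  have h2 : c ≫ (lamB ≫ DB.hat.mulN N) ≫ DualPair.dualIsogenyOver c DA'' DB = lam'' ≫ DA''.hat.mulN (N * N) :=
    comp_comp_mulN_comp_dualIsogenyOver DA'' DB hDA'' hDB c lam'' lamB N hc
  -- cancel `c` on the left and `c^∨` on the right
  have h3 : (d ≫ lam'' ≫ DualPair.dualIsogenyOver d DB DA'') ≫ DualPair.dualIsogenyOver c DA'' DB =
      (lamB ≫ DB.hat.mulN N) ≫ DualPair.dualIsogenyOver c DA'' DB :=
    A''.cancel_left_of_flat_surjective c (by rw [h1, h2])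
  exact B.cancel_right_of_comp_eq_pow_id (DualPair.dualIsogenyOver c DA'' DB) (DualPair.dualIsogenyOver d DB DA'') hN hχ _ _ h3

include hDA hDA'' hDB hN hcd hχ hc in
omit [IsMonHom lam] in
/-- **UPSTAIRS — MULTIPLY**: with `q : A → B` and `q ≫ λ_B ≫ q^∨ = λ ≫ [N]`, the post-composite `u₂ = q ≫ d : A → A″` satisfies `u₂ ≫ λ″ ≫ u₂^∨ = λ ≫ [N·N]`
(`(q ≫ d)^∨ = d^∨ ≫ q^∨`, §1 transfer, ★ `comp_comp_mulN_comp_dualIsogenyOver`). [cite: MumfordAV1970, §15 Thm. 1 (p. 143)] [cite: MumfordFogartyKirwan1994, Ch. 6 §1 Cor. 6.5 (p. 117)] -/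
theorem comp_comp_lam_comp_dualIsogenyOver_of_quasiInverse [Flat c.left] [Surjective c.left] [QuasiCompact c.left]
    (q : A.X ⟶ B.X) [IsMonHom q] (hq : q ≫ lamB ≫ DualPair.dualIsogenyOver q DA DB = lam ≫ DA.hat.mulN N)
    (u₂ : A.X ⟶ A''.X) [IsMonHom u₂] (hu₂ : u₂ = q ≫ d) :
    u₂ ≫ lam'' ≫ DualPair.dualIsogenyOver u₂ DA DA'' = lam ≫ DA.hat.mulN (N * N) := by
  have hQ := comp_lam_comp_dualIsogenyOver_eq_comp_mulN_of_quasiInverse DA'' DB hDA'' hDB c d lam'' lamB hN hcd hχ hc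
  have hm := comp_comp_mulN_comp_dualIsogenyOver DA DB hDA hDB q lam lamB N hq
  rw [← hQ] at hm
  rw [DualPair.dualIsogenyOver_congr DA DA'' (ψ₂ := q ≫ d) (h₂ := inferInstance) hu₂, hu₂, DualPair.dualIsogenyOver_comp q d DA DB DA'']
  simpa only [Category.assoc] using hm

include hDA hDA'' hDB hN hcd hχ hc in
/-- **DOWNSTAIRS — DIVIDE**: with `q̄ : A → B`, if the post-composite `w = q̄ ≫ d : A → A″` satisfies `w ≫ λ″ ≫ w^∨ = λ ≫ [N·N]` then **`q̄ ≫ λ_B ≫ q̄^∨ = λ ≫ [N]`**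
(§1 transfer, then divide by the fppf `[N]`, ★ `comp_lam_comp_dualIsogenyOver_of_comp_mulN` — any characteristic). [cite: MumfordAV1970, §7 Thm. 4 (p. 72) and §15 Thm. 1 (p. 143)] -/
theorem comp_lam_comp_dualIsogenyOver_of_postcomp_of_quasiInverse [Flat c.left] [Surjective c.left] [QuasiCompact c.left]
    (qbar : A.X ⟶ B.X) [IsMonHom qbar] (w : A.X ⟶ A''.X) [IsMonHom w] (hw : w = qbar ≫ d)
    (hlaw : w ≫ lam'' ≫ DualPair.dualIsogenyOver w DA DA'' = lam ≫ DA.hat.mulN (N * N)) :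
    qbar ≫ lamB ≫ DualPair.dualIsogenyOver qbar DA DB = lam ≫ DA.hat.mulN N := by
  have hQ := comp_lam_comp_dualIsogenyOver_eq_comp_mulN_of_quasiInverse DA'' DB hDA'' hDB c d lam'' lamB hN hcd hχ hc
  rw [DualPair.dualIsogenyOver_congr DA DA'' (ψ₂ := qbar ≫ d) (h₂ := inferInstance) hw, hw, DualPair.dualIsogenyOver_comp qbar d DA DB DA''] at hlaw
  have h' : qbar ≫ (lamB ≫ DB.hat.mulN N) ≫ DualPair.dualIsogenyOver qbar DA DB = lam ≫ DA.hat.mulN (N * N) := by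
    rw [← hQ]; simpa only [Category.assoc] using hlaw
  exact comp_lam_comp_dualIsogenyOver_of_comp_mulN DA DB hDA hDB qbar lam lamB hN h'

end QuasiInverse

/-! ## §2 THE HEAD: the legs of the downstairs roof, the polarisation law for any downstairs dual homomorphism through which the cover leg pulls back correctly -/

section Head

variable {K : Type} [Field K] [NumberField K] {v : HeightOneSpectrum (𝓞 K)} {Y : SchemeOver K}
  (𝓨 : IntegralModel (valuationSubringAtPrime K v) K Y) [IsProper 𝓨.total.hom]
  {𝒜 : AbelianSchemeOver 𝓨.total.left} {O : Type*} [CommRing O] (act : 𝒜.RingAction O) [IsCommMonObj 𝒜.X]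
  {m : ℕ} (E' : Matrix (Fin m) (Fin m) O) (hE' : E' * E' = E') (P : Matrix (Fin m) (Fin 1) O) (Q : Matrix (Fin 1) (Fin m) O) {N : ℕ}
  (x x'' : AlgPoints Y (AlgebraicClosure (v.adicCompletion K)))
  (D : 𝒜.DualPair)
  (hD : Nonempty ((Scheme.Modules.pullback (DualPair.unitHatSlice D)).obj D.P ≅ SheafOfModules.unit _))
  (pol : 𝒜.Polarization D)

include hD in
set_option maxHeartbeats 800000 in
/-- **THE LEGS OF THE DOWNSTAIRS ROOF, THROUGH `𝒜`** (★ `exists_roofLeg_specialFibre_sections` WITHOUT `Db`, `λ′`): from an UPSTAIRS roof `𝒜_x —q→ B ←c— 𝒜_{x″}` at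
`x, x″ ∈ Y(Ω̄)` with `q` finite surjective, `c` surjective with `Ker c(Ω̄) = 𝒜_{x″}[𝔭](Ω̄)`, a dual pair `DB` (unit pin) and a dual homomorphism `λ_B` with `q^*λ_B = N·λ_x`,
`c^*λ_B = N·λ_{x″}`, common intertwiners and matching section values, THERE IS **`q̄ : (𝒜 ×_𝓨 𝓨_s)_{x̄} → (𝒞 ×_𝓨 𝓨_s)_{x̄″}`** (`𝒞 = 𝒜 ⊗_𝒪 𝔟` the Serre family of `(E′, P, Q, N)`)
with (r1₀) flat + surjective, (r4₀-q) `ι_{x̄}(a) ≫ q̄ = q̄ ≫ ι^𝒞_{x̄″}(a)`, (r5₀-q) `q̄(τ_i(x̄)) = (τ_i ≫ ψ_P)(x̄″)`, and **(r3₀-q) FOR EVERY downstairs dual pair `DB̄` of `𝒞_{x̄″}` (unit pin)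
and every homomorphism `λ_B̄ : 𝒞_{x̄″} → B̄^` with `c̄ ≫ λ_B̄ ≫ c̄^∨ = λ_{x̄″} ≫ [N]` (`c̄ = ψ_P` at `x̄″`): `q̄ ≫ λ_B̄ ≫ q̄^∨ = λ_{x̄} ≫ [N]`.**  PROOF: ★ organ #2 (`E : 𝒞_{x″} ≅ B`
under `𝒜_{x″}`, `q′ := q ≫ E⁻¹`), ★ (ν8h) `exists_specialFibre_hom_reduction_comp` ONCE for `q′`; (r4₀)(r5₀) as ★ organ #3; (r3₀-q): `d := E⁻¹ ≫ ψ′_{x″}` has `c ≫ d = [N]`,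
`d ≫ c = [N]`, so §1 gives the law of `q′ ≫ ψ′_{x″} = q ≫ d` through `𝒜`'s polarisation with scalar `N²`, (iv-h) transfers it to `q̄ ≫ ψ′_{x̄″}`, and §1 divides downstairs
against `λ_B̄` (quasi-inverse ★ `dualIsogenyOver_coverLeg_comp_eq_pow_id`). [cite: SerreTate1968, §1] [cite: BoschLutkebohmertRaynaud1990, §1.2 Prop. 8 and §7.3 Prop. 6 (p. 180)]
[cite: MumfordAV1970, §7 Thm. 4 (p. 72), §15 Thm. 1 (p. 143), §23 Thm. 2 (p. 231)] [cite: Conrad2004GrossZagier, §7 (Thm. 7.5)] -/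
theorem exists_roofLeg_specialFibre_of_downstairsDual
    (hN : N ≠ 0) (hP : E' * P = P) (hQ : Q * E' = Q)
    (hQP : Q * P = Matrix.scalar (Fin 1) (N : O)) (hPQ : P * Q = Matrix.scalar (Fin m) (N : O) * E')
    {𝔭 : Ideal O} (h𝔭 : Ideal.span (Set.range fun k => P k 0) = 𝔭)
    {J : Type*} (τ : J → 𝒜.Sections)
    -- the upstairs roof at `x, x″`
    {B : AbelianSchemeOver (Spec (.of (AlgebraicClosure (v.adicCompletion K))))}
    (q : ((𝒜.baseChange (𝓨.genericIso'.inv.left ≫ pullback.fst 𝓨.total.hom (specGenericPoint (valuationSubringAtPrime K v) K))).baseChange x.left).X ⟶ B.X)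
    [IsMonHom q] [IsFinite q.left] [Surjective q.left]
    (c : ((𝒜.baseChange (𝓨.genericIso'.inv.left ≫ pullback.fst 𝓨.total.hom (specGenericPoint (valuationSubringAtPrime K v) K))).baseChange x''.left).X ⟶ B.X)
    [IsMonHom c] [Surjective c.left]
    -- (r2) the kernel of `c` on `Ω̄`-points is the `𝔭`-torsion
    (hker : ∀ Pt : ((𝒜.baseChange (𝓨.genericIso'.inv.left ≫ pullback.fst 𝓨.total.hom (specGenericPoint (valuationSubringAtPrime K v) K))).baseChange
        x''.left).toAffine.toAbelianVariety.Points (AlgebraicClosure (v.adicCompletion K)),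
      (AlgPoints.map c Pt : B.toAffine.toAbelianVariety.Points (AlgebraicClosure (v.adicCompletion K))) = 1 ↔
        ∀ a ∈ 𝔭, (AlgPoints.map (((act.baseChange (𝓨.genericIso'.inv.left ≫ pullback.fst 𝓨.total.hom
            (specGenericPoint (valuationSubringAtPrime K v) K))).baseChange x''.left).i a) Pt :
          ((𝒜.baseChange (𝓨.genericIso'.inv.left ≫ pullback.fst 𝓨.total.hom (specGenericPoint (valuationSubringAtPrime K v) K))).baseChange
            x''.left).toAffine.toAbelianVariety.Points (AlgebraicClosure (v.adicCompletion K))) = 1)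
    -- (r3) the polarisation laws of the two legs through the dual homomorphism `λ_B`
    (DB : B.DualPair) (hDB : Nonempty ((Scheme.Modules.pullback (DualPair.unitHatSlice DB)).obj DB.P ≅ SheafOfModules.unit _))
    (lamB : B.X ⟶ DB.hat.X) [IsMonHom lamB]
    (hq3 : q ≫ lamB ≫ DualPair.dualIsogenyOver q
        ((D.baseChange (𝓨.genericIso'.inv.left ≫ pullback.fst 𝓨.total.hom (specGenericPoint (valuationSubringAtPrime K v) K))).baseChange x.left) DB =
      ((pol.baseChange (𝓨.genericIso'.inv.left ≫ pullback.fst 𝓨.total.hom (specGenericPoint (valuationSubringAtPrime K v) K))).baseChange x.left).lam ≫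
        ((D.baseChange (𝓨.genericIso'.inv.left ≫ pullback.fst 𝓨.total.hom (specGenericPoint (valuationSubringAtPrime K v) K))).baseChange x.left).hat.mulN N)
    (hc3 : c ≫ lamB ≫ DualPair.dualIsogenyOver c
        ((D.baseChange (𝓨.genericIso'.inv.left ≫ pullback.fst 𝓨.total.hom (specGenericPoint (valuationSubringAtPrime K v) K))).baseChange x''.left) DB =
      ((pol.baseChange (𝓨.genericIso'.inv.left ≫ pullback.fst 𝓨.total.hom (specGenericPoint (valuationSubringAtPrime K v) K))).baseChange x''.left).lam ≫
        ((D.baseChange (𝓨.genericIso'.inv.left ≫ pullback.fst 𝓨.total.hom (specGenericPoint (valuationSubringAtPrime K v) K))).baseChange x''.left).hat.mulN N)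
    -- (r4) common intertwiners
    (hb : ∀ a : O, ∃ b : B.X ⟶ B.X,
      ((act.baseChange (𝓨.genericIso'.inv.left ≫ pullback.fst 𝓨.total.hom (specGenericPoint (valuationSubringAtPrime K v) K))).baseChange x.left).i a ≫ q =
          q ≫ b ∧
        ((act.baseChange (𝓨.genericIso'.inv.left ≫ pullback.fst 𝓨.total.hom (specGenericPoint (valuationSubringAtPrime K v) K))).baseChange x''.left).i a ≫ c =
          c ≫ b)
    -- (r5) level points correspond
    (hlev : ∀ i : J,
      (AlgPoints.map q ((𝒜.baseChange (𝓨.genericIso'.inv.left ≫ pullback.fst 𝓨.total.hom (specGenericPoint (valuationSubringAtPrime K v) K))).restrictPt x.left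
          (𝒜.sectionBaseChange (𝓨.genericIso'.inv.left ≫ pullback.fst 𝓨.total.hom (specGenericPoint (valuationSubringAtPrime K v) K)) (τ i))) :
          B.toAffine.toAbelianVariety.Points (AlgebraicClosure (v.adicCompletion K))) =
        AlgPoints.map c ((𝒜.baseChange (𝓨.genericIso'.inv.left ≫ pullback.fst 𝓨.total.hom (specGenericPoint (valuationSubringAtPrime K v) K))).restrictPt x''.left
          (𝒜.sectionBaseChange (𝓨.genericIso'.inv.left ≫ pullback.fst 𝓨.total.hom (specGenericPoint (valuationSubringAtPrime K v) K)) (τ i)))) :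
    ∃ (qbar : ((𝒜.baseChange (pullback.fst 𝓨.total.hom (specResidueField v))).baseChange (𝓨.geomReductionMap x).left).X ⟶
               (((serreTensor act E' hE').baseChange (pullback.fst 𝓨.total.hom (specResidueField v))).baseChange (𝓨.geomReductionMap x'').left).X)
      (_ : IsMonHom qbar),
      -- (r1₀)
      (Flat qbar.left ∧ Function.Surjective qbar.left.base) ∧
      -- (r4₀-q)
      (∀ a : O, ((act.baseChange (pullback.fst 𝓨.total.hom (specResidueField v))).baseChange (𝓨.geomReductionMap x).left).i a ≫ qbar =
        qbar ≫ (((serreAction act E' hE').baseChange (pullback.fst 𝓨.total.hom (specResidueField v))).baseChange (𝓨.geomReductionMap x'').left).i a) ∧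
      -- (r5₀-q)
      (∀ i : J,
        AlgPoints.map qbar ((𝒜.baseChange (pullback.fst 𝓨.total.hom (specResidueField v))).restrictPt (𝓨.geomReductionMap x).left
            (𝒜.sectionBaseChange (pullback.fst 𝓨.total.hom (specResidueField v)) (τ i))) =
          ((serreTensor act E' hE').baseChange (pullback.fst 𝓨.total.hom (specResidueField v))).restrictPt (𝓨.geomReductionMap x'').left
            ((serreTensor act E' hE').sectionBaseChange (pullback.fst 𝓨.total.hom (specResidueField v)) (τ i ≫ serreTranslate act E' hE' P))) ∧
      -- (r3₀-q) for ANY downstairs dual pair `DB̄` of the Serre fibre (unit pin) and dual homomorphism `λ_B̄` through which the cover leg `c̄` pulls back to `N·λ_{x̄″}`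
      (∀ (DBs : (((serreTensor act E' hE').baseChange (pullback.fst 𝓨.total.hom (specResidueField v))).baseChange (𝓨.geomReductionMap x'').left).DualPair)
        (_ : Nonempty ((Scheme.Modules.pullback (DualPair.unitHatSlice DBs)).obj DBs.P ≅ SheafOfModules.unit _))
        (lamBs : (((serreTensor act E' hE').baseChange (pullback.fst 𝓨.total.hom (specResidueField v))).baseChange (𝓨.geomReductionMap x'').left).X ⟶ DBs.hat.X) [IsMonHom lamBs],
        (haveI := isMonHom_coverLeg (pullback.fst 𝓨.total.hom (specResidueField v)) (𝓨.geomReductionMap x'').left act E' hE' P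
         baseChangeHom (baseChangeHom (serreTranslate act E' hE' P) (pullback.fst 𝓨.total.hom (specResidueField v))) (𝓨.geomReductionMap x'').left ≫ lamBs ≫
            DualPair.dualIsogenyOver (baseChangeHom (baseChangeHom (serreTranslate act E' hE' P) (pullback.fst 𝓨.total.hom (specResidueField v))) (𝓨.geomReductionMap x'').left)
              ((D.baseChange (pullback.fst 𝓨.total.hom (specResidueField v))).baseChange (𝓨.geomReductionMap x'').left) DBs =
          ((pol.baseChange (pullback.fst 𝓨.total.hom (specResidueField v))).baseChange (𝓨.geomReductionMap x'').left).lam ≫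
            ((D.baseChange (pullback.fst 𝓨.total.hom (specResidueField v))).baseChange (𝓨.geomReductionMap x'').left).hat.mulN N) →
        qbar ≫ lamBs ≫ DualPair.dualIsogenyOver qbar ((D.baseChange (pullback.fst 𝓨.total.hom (specResidueField v))).baseChange (𝓨.geomReductionMap x).left) DBs =
          ((pol.baseChange (pullback.fst 𝓨.total.hom (specResidueField v))).baseChange (𝓨.geomReductionMap x).left).lam ≫
            ((D.baseChange (pullback.fst 𝓨.total.hom (specResidueField v))).baseChange (𝓨.geomReductionMap x).left).hat.mulN N) := by
  haveI := isMonHom_serreTranslate act E' hE' P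
  haveI := isMonHom_serreTranslateInv act E' hE' Q
  haveI := pol.isMonHom
  haveI : CharZero (v.adicCompletion K) := charZero_of_injective_algebraMap (algebraMap K (v.adicCompletion K)).injective
  haveI : IsLocallyNoetherian (specOver K (AlgebraicClosure (v.adicCompletion K))).left :=
    inferInstanceAs (IsLocallyNoetherian (Spec (.of (AlgebraicClosure (v.adicCompletion K)))))
  haveI : IsReduced (specOver K (AlgebraicClosure (v.adicCompletion K))).left :=
    inferInstanceAs (IsReduced (Spec (.of (AlgebraicClosure (v.adicCompletion K)))))
  haveI : IsLocallyNoetherian (specOver v.asIdeal.ResidueField (geomResidueField v)).left :=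
    inferInstanceAs (IsLocallyNoetherian (Spec (.of (geomResidueField v))))
  haveI : IsReduced (specOver v.asIdeal.ResidueField (geomResidueField v)).left :=
    inferInstanceAs (IsReduced (Spec (.of (geomResidueField v))))
  -- STEP 1 (★ organ #2): the middle is the Serre-family fibre, `E : 𝒞_{x″} ≅ B` with `c̄ ≫ E = c`
  obtain ⟨E, hE, hEmon, hEinv, -⟩ := exists_iso_coverLeg_comp_eq_of_forall_points_of_charZero (𝓨.genericIso'.inv.left ≫ pullback.fst 𝓨.total.hom (specGenericPoint (valuationSubringAtPrime K v) K)) x''.left act E' hE' P Q c hN hP hQ hQP hPQ h𝔭 hker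
  haveI := hEmon
  haveI := hEinv
  -- the cover leg and the cover at the generic iterated base change (★ organ #1 ∕ #2)
  haveI hψmon := isMonHom_coverLeg (𝓨.genericIso'.inv.left ≫ pullback.fst 𝓨.total.hom (specGenericPoint (valuationSubringAtPrime K v) K)) x''.left act E' hE' P
  haveI := flat_coverLeg_left (𝓨.genericIso'.inv.left ≫ pullback.fst 𝓨.total.hom (specGenericPoint (valuationSubringAtPrime K v) K)) x''.left act E' hE' P Q hN hP hQ hQP hPQ
  haveI := surjective_coverLeg_left (𝓨.genericIso'.inv.left ≫ pullback.fst 𝓨.total.hom (specGenericPoint (valuationSubringAtPrime K v) K)) x''.left act E' hE' P Q hN hP hQ hQP hPQ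
  haveI := isFinite_coverLeg_left (𝓨.genericIso'.inv.left ≫ pullback.fst 𝓨.total.hom (specGenericPoint (valuationSubringAtPrime K v) K)) x''.left act E' hE' P Q hN hP hQ hQP hPQ
  haveI : QuasiCompact (baseChangeHom (baseChangeHom (serreTranslate act E' hE' P) (𝓨.genericIso'.inv.left ≫ pullback.fst 𝓨.total.hom (specGenericPoint (valuationSubringAtPrime K v) K))) x''.left).left := inferInstance
  haveI : IsMonHom (baseChangeHom (baseChangeHom (serreTranslateInv act E' hE' Q) (𝓨.genericIso'.inv.left ≫ pullback.fst 𝓨.total.hom (specGenericPoint (valuationSubringAtPrime K v) K))) x''.left) :=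
    (haveI := isMonHom_baseChangeHom (serreTranslateInv act E' hE' Q) (𝓨.genericIso'.inv.left ≫ pullback.fst 𝓨.total.hom (specGenericPoint (valuationSubringAtPrime K v) K)); isMonHom_baseChangeHom _ x''.left)
  -- STEP 2: `q′ := q ≫ E⁻¹`, finite surjective
  haveI : IsFinite (q ≫ E.inv).left := isFinite_retarget_left q E
  haveI : Surjective (q ≫ E.inv).left := surjective_retarget_left q E
  -- STEP 3 (★ (ν8h)): reduce `q′`, keeping the post-composition transfer (iv-h)
  obtain ⟨qbar, hqmon, h1, h2, h3, -, h5⟩ := exists_specialFibre_hom_reduction_comp 𝓨 𝒜 (serreTensor act E' hE') x x'' (q ≫ E.inv)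
  haveI := hqmon
  refine ⟨qbar, hqmon, h1 inferInstance inferInstance, ?_, ?_, ?_⟩
  · -- (r4₀-q): common intertwiners re-target (★ organ #2) then transfer (★ (ν8)(ii))
    intro a
    haveI := act.isMonHom a
    haveI := (serreAction act E' hE').isMonHom a
    obtain ⟨b, hqb, hcb⟩ := hb a
    exact h2 (act.i a) ((serreAction act E' hE').i a)
      (i_comp_retarget_of_common_intertwiner q c (baseChangeHom (baseChangeHom (serreTranslate act E' hE' P) (𝓨.genericIso'.inv.left ≫ pullback.fst 𝓨.total.hom (specGenericPoint (valuationSubringAtPrime K v) K))) x''.left) E hE hqb hcb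
        (i_comp_coverLeg (𝓨.genericIso'.inv.left ≫ pullback.fst 𝓨.total.hom (specGenericPoint (valuationSubringAtPrime K v) K)) x''.left act E' hE' P hP a))
  · -- (r5₀-q): point identities re-target (★ organ #2) then transfer (★ (ν8)(iii)) — sections edition
    intro i
    have hup : AlgPoints.map (q ≫ E.inv) ((𝒜.baseChange (𝓨.genericIso'.inv.left ≫ pullback.fst 𝓨.total.hom (specGenericPoint (valuationSubringAtPrime K v) K))).restrictPt x.left (𝒜.sectionBaseChange (𝓨.genericIso'.inv.left ≫ pullback.fst 𝓨.total.hom (specGenericPoint (valuationSubringAtPrime K v) K)) (τ i))) =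
        ((serreTensor act E' hE').baseChange (𝓨.genericIso'.inv.left ≫ pullback.fst 𝓨.total.hom (specGenericPoint (valuationSubringAtPrime K v) K))).restrictPt x''.left
          ((serreTensor act E' hE').sectionBaseChange (𝓨.genericIso'.inv.left ≫ pullback.fst 𝓨.total.hom (specGenericPoint (valuationSubringAtPrime K v) K)) (τ i ≫ serreTranslate act E' hE' P)) := by
      rw [map_retarget_eq_map q c (baseChangeHom (baseChangeHom (serreTranslate act E' hE' P) (𝓨.genericIso'.inv.left ≫ pullback.fst 𝓨.total.hom (specGenericPoint (valuationSubringAtPrime K v) K))) x''.left) E hE _ _ (hlev i),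
        sectionBaseChange_comp, ← map_fibreHom_restrictPt x''.left (baseChangeHom (serreTranslate act E' hE' P) (𝓨.genericIso'.inv.left ≫ pullback.fst 𝓨.total.hom (specGenericPoint (valuationSubringAtPrime K v) K)))]
      rfl
    exact h3 (τ i) (τ i ≫ serreTranslate act E' hE' P) hup
  · -- (r3₀-q) THROUGH `𝒜`: upstairs multiply (§1) → (iv-h) → downstairs divide (§1)
    intro DBs hDBs lamBs _ hc3s
    -- unit pins of the base-changed dual pairs of `𝒜`
    have hDηx := DualPair.nonempty_unitHatSlice_baseChange_iso (g := x.left) _ (DualPair.nonempty_unitHatSlice_baseChange_iso (g := (𝓨.genericIso'.inv.left ≫ pullback.fst 𝓨.total.hom (specGenericPoint (valuationSubringAtPrime K v) K))) D hD)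
    have hDη'' := DualPair.nonempty_unitHatSlice_baseChange_iso (g := x''.left) _ (DualPair.nonempty_unitHatSlice_baseChange_iso (g := (𝓨.genericIso'.inv.left ≫ pullback.fst 𝓨.total.hom (specGenericPoint (valuationSubringAtPrime K v) K))) D hD)
    have hDs := DualPair.nonempty_unitHatSlice_baseChange_iso (g := (𝓨.geomReductionMap x).left) _ (DualPair.nonempty_unitHatSlice_baseChange_iso (g := (pullback.fst 𝓨.total.hom (specResidueField v))) D hD)
    have hDs'' := DualPair.nonempty_unitHatSlice_baseChange_iso (g := (𝓨.geomReductionMap x'').left) _ (DualPair.nonempty_unitHatSlice_baseChange_iso (g := (pullback.fst 𝓨.total.hom (specResidueField v))) D hD)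
    haveI := ((pol.baseChange (𝓨.genericIso'.inv.left ≫ pullback.fst 𝓨.total.hom (specGenericPoint (valuationSubringAtPrime K v) K))).baseChange x.left).isMonHom
    haveI := ((pol.baseChange (𝓨.genericIso'.inv.left ≫ pullback.fst 𝓨.total.hom (specGenericPoint (valuationSubringAtPrime K v) K))).baseChange x''.left).isMonHom
    haveI := ((pol.baseChange (pullback.fst 𝓨.total.hom (specResidueField v))).baseChange (𝓨.geomReductionMap x).left).isMonHom
    haveI := ((pol.baseChange (pullback.fst 𝓨.total.hom (specResidueField v))).baseChange (𝓨.geomReductionMap x'').left).isMonHom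
    haveI : IsCommMonObj B.X := B.isCommMonObj_of_isReduced_base
    haveI : IsMonHom (B.mulN N) := B.isMonHom_mulN N
    -- `c` is fppf (it is `c̄_η ≫ E`)
    haveI : Flat c.left := by rw [← hE]; exact flat_retarget_left (baseChangeHom (baseChangeHom (serreTranslate act E' hE' P) (𝓨.genericIso'.inv.left ≫ pullback.fst 𝓨.total.hom (specGenericPoint (valuationSubringAtPrime K v) K))) x''.left) E.symm
    haveI : IsFinite c.left := by
      rw [← hE]; exact isFinite_retarget_left (baseChangeHom (baseChangeHom (serreTranslate act E' hE' P) (𝓨.genericIso'.inv.left ≫ pullback.fst 𝓨.total.hom (specGenericPoint (valuationSubringAtPrime K v) K))) x''.left) E.symm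
    haveI : QuasiCompact c.left := inferInstance
    -- UPSTAIRS: `d := E⁻¹ ≫ ψ′_{x″}` is a quasi-inverse of `c`: `c ≫ d = [N]`, `d ≫ c = [N]`, hence `c^∨ ≫ d^∨ = [N]`
    have hcd : c ≫ (E.inv ≫ baseChangeHom (baseChangeHom (serreTranslateInv act E' hE' Q) (𝓨.genericIso'.inv.left ≫ pullback.fst 𝓨.total.hom (specGenericPoint (valuationSubringAtPrime K v) K))) x''.left) =
        (𝟙 ((𝒜.baseChange (𝓨.genericIso'.inv.left ≫ pullback.fst 𝓨.total.hom (specGenericPoint (valuationSubringAtPrime K v) K))).baseChange x''.left).X) ^ N := by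
      rw [← hE, Category.assoc, E.hom_inv_id_assoc]
      exact baseChangeHom_comp_eq_pow_id_of_comp_eq_pow_id x''.left _ _
        (baseChangeHom_comp_eq_pow_id_of_comp_eq_pow_id (𝓨.genericIso'.inv.left ≫ pullback.fst 𝓨.total.hom (specGenericPoint (valuationSubringAtPrime K v) K)) _ _ (serreTranslate_comp_serreTranslateInv act E' hE' P Q hP hQ hQP))
    have hdc : (E.inv ≫ baseChangeHom (baseChangeHom (serreTranslateInv act E' hE' Q) (𝓨.genericIso'.inv.left ≫ pullback.fst 𝓨.total.hom (specGenericPoint (valuationSubringAtPrime K v) K))) x''.left) ≫ c = B.mulN N := by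
      rw [← hE, Category.assoc, ← Category.assoc (baseChangeHom (baseChangeHom (serreTranslateInv act E' hE' Q) (𝓨.genericIso'.inv.left ≫ pullback.fst 𝓨.total.hom (specGenericPoint (valuationSubringAtPrime K v) K))) x''.left),
        coverLegInv_comp_coverLeg (𝓨.genericIso'.inv.left ≫ pullback.fst 𝓨.total.hom (specGenericPoint (valuationSubringAtPrime K v) K)) x''.left act E' hE' P Q hP hQ hPQ, ← Category.assoc, comp_pow_id_eq_pow_id_comp B E.inv N,
        Category.assoc, E.inv_hom_id, Category.comp_id, mulN_def]
    have hχ : DualPair.dualIsogenyOver c ((D.baseChange (𝓨.genericIso'.inv.left ≫ pullback.fst 𝓨.total.hom (specGenericPoint (valuationSubringAtPrime K v) K))).baseChange x''.left) DB ≫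
        DualPair.dualIsogenyOver (E.inv ≫ baseChangeHom (baseChangeHom (serreTranslateInv act E' hE' Q) (𝓨.genericIso'.inv.left ≫ pullback.fst 𝓨.total.hom (specGenericPoint (valuationSubringAtPrime K v) K))) x''.left) DB ((D.baseChange (𝓨.genericIso'.inv.left ≫ pullback.fst 𝓨.total.hom (specGenericPoint (valuationSubringAtPrime K v) K))).baseChange x''.left) =
        (𝟙 DB.hat.X) ^ N := by
      rw [← DualPair.dualIsogenyOver_comp _ _ DB ((D.baseChange (𝓨.genericIso'.inv.left ≫ pullback.fst 𝓨.total.hom (specGenericPoint (valuationSubringAtPrime K v) K))).baseChange x''.left) DB,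
        DualPair.dualIsogenyOver_congr DB DB (ψ₂ := B.mulN N) (h₂ := inferInstance) hdc, DualPair.dualIsogenyOver_mulN DB hDB N, mulN_def]
    have hup := comp_comp_lam_comp_dualIsogenyOver_of_quasiInverse ((D.baseChange (𝓨.genericIso'.inv.left ≫ pullback.fst 𝓨.total.hom (specGenericPoint (valuationSubringAtPrime K v) K))).baseChange x.left) ((D.baseChange (𝓨.genericIso'.inv.left ≫ pullback.fst 𝓨.total.hom (specGenericPoint (valuationSubringAtPrime K v) K))).baseChange x''.left) DB hDηx hDη'' hDB
      c (E.inv ≫ baseChangeHom (baseChangeHom (serreTranslateInv act E' hE' Q) (𝓨.genericIso'.inv.left ≫ pullback.fst 𝓨.total.hom (specGenericPoint (valuationSubringAtPrime K v) K))) x''.left)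
      ((pol.baseChange (𝓨.genericIso'.inv.left ≫ pullback.fst 𝓨.total.hom (specGenericPoint (valuationSubringAtPrime K v) K))).baseChange x.left).lam ((pol.baseChange (𝓨.genericIso'.inv.left ≫ pullback.fst 𝓨.total.hom (specGenericPoint (valuationSubringAtPrime K v) K))).baseChange x''.left).lam lamB hN hcd hχ hc3 q hq3
      ((q ≫ E.inv) ≫ baseChangeHom (baseChangeHom (serreTranslateInv act E' hE' Q) (𝓨.genericIso'.inv.left ≫ pullback.fst 𝓨.total.hom (specGenericPoint (valuationSubringAtPrime K v) K))) x''.left) (Category.assoc _ _ _)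
    -- TRANSFER (★ (ν8h) (iv-h)) with `ℰ := 𝒜`, `h := ψ′`
    haveI : IsMonHom (baseChangeHom (baseChangeHom (serreTranslateInv act E' hE' Q) (pullback.fst 𝓨.total.hom (specResidueField v))) (𝓨.geomReductionMap x'').left) :=
      (haveI := isMonHom_baseChangeHom (serreTranslateInv act E' hE' Q) (pullback.fst 𝓨.total.hom (specResidueField v)); isMonHom_baseChangeHom _ (𝓨.geomReductionMap x'').left)
    have hdown := h5 𝒜 (serreTranslateInv act E' hE' Q) ((q ≫ E.inv) ≫ baseChangeHom (baseChangeHom (serreTranslateInv act E' hE' Q) (𝓨.genericIso'.inv.left ≫ pullback.fst 𝓨.total.hom (specGenericPoint (valuationSubringAtPrime K v) K))) x''.left) rfl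
      D pol D pol (N * N) hup (qbar ≫ baseChangeHom (baseChangeHom (serreTranslateInv act E' hE' Q) (pullback.fst 𝓨.total.hom (specResidueField v))) (𝓨.geomReductionMap x'').left) rfl
    -- DOWNSTAIRS: `ψ′_{x̄″}` is a quasi-inverse of the cover leg `c̄` (★ organ #1 ∕ #2), divide by `[N]`
    haveI := isMonHom_coverLeg (pullback.fst 𝓨.total.hom (specResidueField v)) (𝓨.geomReductionMap x'').left act E' hE' P
    haveI := flat_coverLeg_left (pullback.fst 𝓨.total.hom (specResidueField v)) (𝓨.geomReductionMap x'').left act E' hE' P Q hN hP hQ hQP hPQ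
    haveI := surjective_coverLeg_left (pullback.fst 𝓨.total.hom (specResidueField v)) (𝓨.geomReductionMap x'').left act E' hE' P Q hN hP hQ hQP hPQ
    haveI := isFinite_coverLeg_left (pullback.fst 𝓨.total.hom (specResidueField v)) (𝓨.geomReductionMap x'').left act E' hE' P Q hN hP hQ hQP hPQ
    haveI : QuasiCompact (baseChangeHom (baseChangeHom (serreTranslate act E' hE' P) (pullback.fst 𝓨.total.hom (specResidueField v))) (𝓨.geomReductionMap x'').left).left := inferInstance
    have hcds : baseChangeHom (baseChangeHom (serreTranslate act E' hE' P) (pullback.fst 𝓨.total.hom (specResidueField v))) (𝓨.geomReductionMap x'').left ≫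
        baseChangeHom (baseChangeHom (serreTranslateInv act E' hE' Q) (pullback.fst 𝓨.total.hom (specResidueField v))) (𝓨.geomReductionMap x'').left =
        (𝟙 ((𝒜.baseChange (pullback.fst 𝓨.total.hom (specResidueField v))).baseChange (𝓨.geomReductionMap x'').left).X) ^ N :=
      baseChangeHom_comp_eq_pow_id_of_comp_eq_pow_id (𝓨.geomReductionMap x'').left _ _
        (baseChangeHom_comp_eq_pow_id_of_comp_eq_pow_id (pullback.fst 𝓨.total.hom (specResidueField v)) _ _ (serreTranslate_comp_serreTranslateInv act E' hE' P Q hP hQ hQP))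
    have hχs := dualIsogenyOver_coverLeg_comp_eq_pow_id (pullback.fst 𝓨.total.hom (specResidueField v)) (𝓨.geomReductionMap x'').left act E' hE' P Q hP hQ hPQ ((D.baseChange (pullback.fst 𝓨.total.hom (specResidueField v))).baseChange (𝓨.geomReductionMap x'').left) DBs hDBs
    exact comp_lam_comp_dualIsogenyOver_of_postcomp_of_quasiInverse ((D.baseChange (pullback.fst 𝓨.total.hom (specResidueField v))).baseChange (𝓨.geomReductionMap x).left) ((D.baseChange (pullback.fst 𝓨.total.hom (specResidueField v))).baseChange (𝓨.geomReductionMap x'').left) DBs hDs hDs'' hDBs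
      (baseChangeHom (baseChangeHom (serreTranslate act E' hE' P) (pullback.fst 𝓨.total.hom (specResidueField v))) (𝓨.geomReductionMap x'').left) (baseChangeHom (baseChangeHom (serreTranslateInv act E' hE' Q) (pullback.fst 𝓨.total.hom (specResidueField v))) (𝓨.geomReductionMap x'').left)
      ((pol.baseChange (pullback.fst 𝓨.total.hom (specResidueField v))).baseChange (𝓨.geomReductionMap x).left).lam ((pol.baseChange (pullback.fst 𝓨.total.hom (specResidueField v))).baseChange (𝓨.geomReductionMap x'').left).lam lamBs hN hcds hχs hc3s
      qbar (qbar ≫ baseChangeHom (baseChangeHom (serreTranslateInv act E' hE' Q) (pullback.fst 𝓨.total.hom (specResidueField v))) (𝓨.geomReductionMap x'').left) rfl hdown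

end Head

end AbelianSchemeOver

end Literature.AlgebraicGeometry.AbelianSchemes

end
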